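import Literature.NumberTheory.EllipticCurves.Rank1Residual.Typed.Basic
import HarnessLib

/-!
# Class X3 (Eisenstein additive `p`) — TYPED missing input (cell `b2b-bsdres`)

HONEST FRAMING (run/shared/lean/b2b/bsd-rank1-residual/): construction-shaped classes are TYPED
(missing input named; required output at `(E,p)` stated), NOT attempted; the cell deletes only the
combination-shaped classes, from published theorems; this is not "finishing BSD".

**Class X3** (RESIDUAL-CASES §a.2 v3; `Rank1Residual.ClassX3 W p := Red W p ∧ Addv W p`): `E[p]`
reducible and `E` additive at `p` (forces `p ∈ {2, 3, 5, 7, 13}` or Mazur's list; census examples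
`54a1, 54b1, 90a1, 90b1, 90c1, 126a1 @3`, `50b1, 75c1 @5`). Census v3: 335 pairs with `N < 2500`
(308 at `p = 3`), 745 with `N < 10⁴` — the largest open class. Label: CONSTRUCTION-SHAPED (high).

**What kind of object is missing.** ANY Kato-side integrality statement or Iwasawa main conjecture
WITH a control theorem to the leading term at an ADDITIVE prime `p` with REDUCIBLE `E[p]` — there is
no ordinary / signed local condition at an additive prime, no Mazur–Tate–Teitelbaum `p`-adic
`L`-function, and the Eisenstein (reducible) techniques (Greenberg–Vatsal, Castella–Grossi–Skinner,
Keller–Yin) all assume good or multiplicative reduction at `p`. Both halves of the output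
(`MissingLowerBoundAt`, `MissingUpperBoundAt`) are missing at the class level.

**Closest published results, verbatim, and why they do not reach X3.**
* Wuthrich, Doc. Math. 19 (2014), Prop. 21 (p. 400): `#Ш(E/ℚ) ∣ C·(L(E,1)/Ω_E⁺)·#E(ℚ)²/∏ c_v`
  with `C` "only divisible by 2, primes of additive reduction or primes for which the Galois
  representation on `E[p]` is neither surjective nor contained in a Borel subgroup" — additive `p`
  is EXCLUDED explicitly (it may divide `C`); likewise Thm. 16 needs "semi-stable reduction at `p`".
* C.-H. Kim, K. Nakamura, J. Number Theory (2020) = arXiv:1808.07726 ("IMC without `p`-adic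
  `L`-functions" numerical criterion at additive odd `p`) and C.-H. Kim, Amer. J. Math. 148 (2026)
  Thm. 1.8 (tree `Kim2022_*`) require a BIG (surjective) image — `E[p]` reducible is excluded.
* Keller–Yin, arXiv:2410.23241v1 (PRE): a `p`-CONVERSE for potentially good ordinary reduction at
  Eisenstein primes — no leading-term formula is claimed.
* Below `N = 5000` every X3 pair is nevertheless decided in print by explicit isogeny descents
  (Creutz–Miller 2012 Thm. 1.1, tree fact `bsdp_of_reducible_of_conductor_lt`), a per-curve
  computation, not a class theorem.

This file: `X3.MissingInputAt W p := MissingPPartAt W p` (both ranks, both halves) and the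
conditional class theorem `X3.bsdp_of_missingInputAt`. The universally quantified statement over the
class is not a Literature statement (nothing in print proves it); it is recorded in CLASSES.md.
-/

noncomputable section

open scoped Classical

open WeierstrassCurve Literature.NumberTheory.EllipticCurves
  Literature.NumberTheory.EllipticCurves.Rank1Residual

namespace Literature.NumberTheory.EllipticCurves.Rank1Residual.Typed

/-- **X3 — the missing input at `(E, p)`, typed**: at an additive Eisenstein prime NOTHING of the
`p`-part is in print at the class level (Wuthrich 2014 Prop. 21 / Thm. 16 exclude additive `p`;
Kim–Nakamura 2020 and Kim 2026 need surjective `ρ̄_{E,p}`; Keller–Yin 2410.23241 is a `p`-converse,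
unrefereed), so the missing input is the whole output `MissingPPartAt W p` — to be supplied by an
IMC-with-control / Kato-side integrality at an additive prime with reducible `E[p]`, an object for
which no theory is in print. Nothing asserted. [cite: Wuthrich2014, Prop. 21 (p. 400, the constant C) (shape only; nothing asserted)] [cite: Kim2022StructureSelmer, Thm. 1.8 (hypothesis: surjective image) (shape only; nothing asserted)] -/
def X3.MissingInputAt (W : WeierstrassCurve ℚ) (p : ℕ) : Prop := MissingPPartAt W p

/-- **X3 conditional class theorem**: in analytic rank `≤ 1`, the typed missing input at an X3 pair
yields Miller's `BSD(E,p)` (GZK `hGZK` for rank and finiteness). [cite: Miller2011LMS, §1 and Def. 1.1] -/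
theorem X3.bsdp_of_missingInputAt (hGZK : rank_eq_analyticRank_of_analyticRank_le_one)
    (W : WeierstrassCurve ℚ) [W.IsElliptic] [W.IsGloballyMinimal] (p : ℕ) [Fact p.Prime]
    (hr : W.analyticRank ≤ 1) (_hX : ClassX3 W p) (hmiss : X3.MissingInputAt W p) : BSDp W p :=
  bsdp_of_missingPPartAt W p hGZK hr hmiss

end Literature.NumberTheory.EllipticCurves.Rank1Residual.Typed
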